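import Summits.ValiantsHypothesis.ValiantsHypothesis.Theorems.LacunarySymmetroidMatrixDescartesCensusPivotKit

/-!
# `MatrixDescartes` census — pivot column: R1 `RankOnePivotLaw` is FALSE (an index-1 `2 × 2` pencil with FIVE positive roots)

HONEST FRAMING.  Kernel certificate for the object-search cell `pub-symmetroid`'s Conjecture-B column in pivot currency
(`…CensusPivotDefs.lean`; seat conjb-1 g0, object and proof idea of `pub-symmetroid-conjb-1/NotRankOnePivotLaw.lean`
(farm rc 0, 2026-08-25), exact Sturm count in `r1-kill/`; restated def-free on the tree's certificate kit by the typer g8).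
THE OBJECT («softmax staircase», first member): the `2 × 2` pivot pencil

  `F(x) = x⁴ • J + x⁵ • diag(6,0) + x¹⁶ • diag(3,0) + x⁰ • diag(0,25) + x⁶ • diag(0,1)`,
  `J = !![-2,-18;-18,-6] = diag(2,75) − w wᵀ`, `w = (2,9)` (so `J + w wᵀ ⪰ 0`: pivot index `1`),

has `det F(x) = 3x²² − 18x²⁰ + 75x¹⁶ + 6x¹¹ − 2x¹⁰ − 36x⁹ − 312x⁸ + 150x⁵ − 50x⁴`, which takes the signs
`− + − + − +` at `x = 3/10, 9/20, 3/5, 7/5, 17/10, 5/2`, hence `Z₊ ≥ 5 > 4 = 2m` (exactly 5 by Sturm, not needed here).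
Consequences: `not_rankOnePivotLaw : ¬ RankOnePivotLaw` (R1 dead: at index 1, `Z₊` is not bounded by `2m`) and the
`K = 4` member of the staircase family, `rankOneStaircase_four : ¬ PivotRootLawAt 2 4 1 (2·4 − 4)` (`Z₊ ≥ 2K − 3 = 5`).
Mechanism (conjb-1 g0): in `t = log x` the roots solve `w₁²/p₁(t) + w₂²/p₂(t) = 1` with posynomial channels `pᵢ`; a
change of dominant term in `p₁` while `1/p₂` rises creates an extra oscillation.
Landed as a HELPER of the crux item stmt-ValiantsHypothesis-18050 with no closure claim; index-1 pivot pencils only —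
nothing here bears on `Theses.LacunarySymmetroid.MatrixDescartes`, on `KPlusLogSqLaw`, on the census registers, or on
`VP ≠ VNP`.

[folklore] Intermediate value theorem at rational points (`norm_num`); the object is the cell's (conjb-1 g0).
-/

-- `Summit.ValiantsHypothesis.ValiantsHypothesis.…` repeats a component by the D-0017 layout
-- (single-conjunct summit), which the `dupNamespace` linter flags; the name is mandated.
set_option linter.dupNamespace false

namespace Summit.ValiantsHypothesis.ValiantsHypothesis.Theorems.LacunarySymmetroidMatrixDescartes.Pivot

open scoped BigOperators Matrix

/-- Closed form of `det F(t)` for conjb-1 g0's five-root index-1 object (pivot exponent `4`, pivot letter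
`!![-2,-18;-18,-6]`, diagonal PSD letters `diag(6,0), diag(3,0), diag(0,25), diag(0,1)` at exponents `5, 16, 0, 6`).
The literals in this statement ARE the certificate's data; the theorems below read them off by unification. [folklore] -/
theorem rankOne_eval_det (t : ℝ) :
    (t ^ 4 • (!![-2, -18; -18, -6] : Matrix (Fin 2) (Fin 2) ℝ)
      + ∑ k, t ^ (![5, 16, 0, 6] : Fin 4 → ℕ) k •
        (![Matrix.diagonal ![6, 0], Matrix.diagonal ![3, 0], Matrix.diagonal ![0, 25], Matrix.diagonal ![0, 1]]
          : Fin 4 → Matrix (Fin 2) (Fin 2) ℝ) k).det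
      = 3 * t ^ 22 - 18 * t ^ 20 + 75 * t ^ 16 + 6 * t ^ 11 - 2 * t ^ 10 - 36 * t ^ 9 - 312 * t ^ 8
          + 150 * t ^ 5 - 50 * t ^ 4 := by
  rw [Matrix.det_fin_two]
  simp [Matrix.add_apply, Matrix.smul_apply, Fin.sum_univ_four, Matrix.diagonal_apply_eq, Matrix.diagonal_apply_ne]
  ring

/-- **Five distinct positive roots**: `5 ≤ Z₊` of conjb-1 g0's index-1 object (signs `− + − + − +` of the closed form at
`3/10 < 9/20 < 3/5 < 7/5 < 17/10 < 5/2`). [folklore] -/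
theorem five_le_pivotPosRoots :
    5 ≤ pivotPosRoots 4 (![5, 16, 0, 6] : Fin 4 → ℕ) (!![-2, -18; -18, -6] : Matrix (Fin 2) (Fin 2) ℝ)
      (![Matrix.diagonal ![6, 0], Matrix.diagonal ![3, 0], Matrix.diagonal ![0, 25], Matrix.diagonal ![0, 1]]
        : Fin 4 → Matrix (Fin 2) (Fin 2) ℝ) :=
  le_pivotPosRoots_of_certificate (N := 5) rankOne_eval_det
    ![3 / 10, 9 / 20, 3 / 5, 7 / 5, 17 / 10, 5 / 2]
    (by
      refine Fin.strictMono_iff_lt_succ.2 fun j => ?_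
      fin_cases j <;> simp only [Fin.castSucc_mk, Fin.succ_mk] <;> norm_num)
    (by intro j; fin_cases j <;> norm_num)
    (by intro j; fin_cases j <;> simp only [Fin.castSucc_mk, Fin.succ_mk] <;> norm_num)

/-- The pivot letter `J = !![-2,-18;-18,-6]` has index `1`: `J + w wᵀ = diag(2, 75) ⪰ 0` for `w = (2, 9)`. [folklore] -/
theorem rankOne_index_one :
    ((!![-2, -18; -18, -6] : Matrix (Fin 2) (Fin 2) ℝ)
      + (Matrix.of fun (i : Fin 2) (_ : Fin 1) => (![2, 9] : Fin 2 → ℝ) i)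
        * (Matrix.of fun (i : Fin 2) (_ : Fin 1) => (![2, 9] : Fin 2 → ℝ) i)ᵀ).PosSemidef := by
  have h : (!![-2, -18; -18, -6] : Matrix (Fin 2) (Fin 2) ℝ)
      + (Matrix.of fun (i : Fin 2) (_ : Fin 1) => (![2, 9] : Fin 2 → ℝ) i)
        * (Matrix.of fun (i : Fin 2) (_ : Fin 1) => (![2, 9] : Fin 2 → ℝ) i)ᵀ = Matrix.diagonal ![2, 75] := by
    ext i j
    fin_cases i <;> fin_cases j <;> simp [Matrix.mul_apply] <;> norm_num
  rw [h, Matrix.posSemidef_diagonal_iff]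
  intro i; fin_cases i <;> simp

/-- **The row `Z₊ ≤ 4` FAILS at format `(2,4)`, index `1`** (`5` roots; this is both `¬(Z₊ ≤ 2m)` and the `K = 4` member
`Z₊ ≥ 2K − 3` of the staircase family). [folklore] -/
theorem not_pivotRootLawAt_two_four_one_four : ¬ PivotRootLawAt 2 4 1 4 :=
  not_pivotRootLawAt_of_certificate (N := 5) rankOne_eval_det
    (by unfold Matrix.IsSymm; ext i j; fin_cases i <;> fin_cases j <;> rfl)
    (by intro k; fin_cases k <;> simp [Matrix.posSemidef_diagonal_iff, Fin.forall_fin_two])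
    (Matrix.of fun (i : Fin 2) (_ : Fin 1) => (![2, 9] : Fin 2 → ℝ) i) rankOne_index_one
    ![3 / 10, 9 / 20, 3 / 5, 7 / 5, 17 / 10, 5 / 2]
    (by
      refine Fin.strictMono_iff_lt_succ.2 fun j => ?_
      fin_cases j <;> simp only [Fin.castSucc_mk, Fin.succ_mk] <;> norm_num)
    (by intro j; fin_cases j <;> norm_num)
    (by intro j; fin_cases j <;> simp only [Fin.castSucc_mk, Fin.succ_mk] <;> norm_num)
    (by norm_num)

/-- **R1 is FALSE** (conjb-1 g0): the rank-one pivot law «index `1 ⇒ Z₊ ≤ 2m` uniformly in `K`» fails at `(m,K) = (2,4)`. -/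
theorem not_rankOnePivotLaw : ¬ RankOnePivotLaw :=
  fun h => not_pivotRootLawAt_two_four_one_four (h 2 4)

/-- **Staircase member `K = 4`**: `¬ PivotRootLawAt 2 4 1 (2·4 − 4)`, i.e. `Z₊ ≥ 2K − 3 = 5` is attained at `(2,4)`,
index `1` (the instance `K = 4` of `RankOneStaircase`). -/
theorem rankOneStaircase_four : ¬ PivotRootLawAt 2 4 1 (2 * 4 - 4) :=
  not_pivotRootLawAt_two_four_one_four

end Summit.ValiantsHypothesis.ValiantsHypothesis.Theorems.LacunarySymmetroidMatrixDescartes.Pivot
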